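import Mathlib

/-!
# Crux `HodgeAbelianVarieties` (stmt-HodgeConjecture-1333), line `cm-pivot-andre` — helper W7: the elementary-symmetric criterion for a constant multiset

In the lead's André construction the "single-embedding" wedge monomials of `Hᵈ(B(ℂ); ℂ)` are cut
out as the joint kernel of the rational operators `R_k = dᵏ E_k − C(d,k) E₁ᵏ`, whose eigenvalue on a
monomial with conjugate-multiset `M` (of cardinality `d`) is `dᵏ e_k(M) − C(d,k) e₁(M)ᵏ`. This file
is the pure algebra behind it (`esymm_power_criterion`, registered helper W7): for a multiset
`M` of `d > 0` complex numbers,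

  `(∀ k ≤ d, dᵏ · e_k(M) = C(d,k) · e₁(M)ᵏ) ↔ M` is constant (`M = replicate d r`).

Proof.
* `esymm_replicate`: `e_k(replicate d r) = C(d,k) rᵏ` — every `k`-sub-multiset of `replicate d r`
  is `replicate k r` (`Multiset.eq_replicate`), with product `rᵏ`, and there are `C(d,k)` of them
  (`Multiset.card_powersetCard`). This gives `⇐` at once (`e₁ = d r`).
* `⇒`: with `c := e₁(M) / d` the hypothesis reads `e_k(M) = C(d,k) cᵏ = e_k(replicate d c)`
  for all `k ≤ d`, so by Vieta (`Multiset.prod_X_add_C_eq_sum_esymm`)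
  `∏_{r ∈ M} (X + r) = ∏_{r ∈ replicate d c} (X + r)`; reading off the roots
  (`Polynomial.roots_multiset_prod_X_sub_C` after `X + C r = X - C (-r)`) gives
  `M.map Neg.neg = (replicate d c).map Neg.neg`, whence `M = replicate d c` (`Multiset.map_injective`).

Mathlib only; no definition, no named fact.

## References

* [folklore] Newton/Maclaurin: equality `e_k / C(d,k) = (e₁/d)ᵏ` for all `k` forces all roots equal
  (over `ℂ`, by unique factorisation of `∏ (X + r)`).
-/

set_option linter.dupNamespace false

noncomputable section

namespace Summit.HodgeConjecture.HodgeConjecture.Theorems.HodgeAbelianVarieties.CMPivotAndre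

open Polynomial

/-- **Elementary symmetric functions of a constant multiset**: `e_k(r, …, r) = C(d,k) · rᵏ`
(`d` copies of `r`). Every `k`-sub-multiset of `replicate d r` is `replicate k r`
(`Multiset.eq_replicate`), of product `rᵏ`, and there are `C(d,k)` of them
(`Multiset.card_powersetCard`). [folklore] -/
theorem esymm_replicate {R : Type*} [CommSemiring R] (d k : ℕ) (r : R) :
    (Multiset.replicate d r).esymm k = (d.choose k : R) * r ^ k := by
  rw [Multiset.esymm]
  have hmap : ((Multiset.replicate d r).powersetCard k).map Multiset.prod =
      ((Multiset.replicate d r).powersetCard k).map fun _ => r ^ k := by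
    refine Multiset.map_congr rfl fun x hx => ?_
    rw [Multiset.mem_powersetCard] at hx
    rw [Multiset.eq_replicate.2 ⟨hx.2, fun b hb => Multiset.eq_of_mem_replicate
      (Multiset.mem_of_le hx.1 hb)⟩, Multiset.prod_replicate]
  rw [hmap, Multiset.map_const', Multiset.sum_replicate, Multiset.card_powersetCard,
    Multiset.card_replicate, nsmul_eq_mul]

/-- **Roots of `∏_{r ∈ s} (X + r)`**: the multiset of roots of `(s.map fun r => X + C r).prod` is
`s.map Neg.neg` (`X + C r = X - C (-r)` and `Polynomial.roots_multiset_prod_X_sub_C`). [folklore] -/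
theorem roots_multiset_prod_X_add_C {R : Type*} [CommRing R] [IsDomain R] (s : Multiset R) :
    (s.map fun r => X + C r).prod.roots = s.map Neg.neg := by
  have hs : (s.map fun r => X + C r) = (s.map Neg.neg).map fun a => X - C a := by
    rw [Multiset.map_map]
    refine Multiset.map_congr rfl fun r _ => ?_
    simp [sub_eq_add_neg]
  rw [hs, roots_multiset_prod_X_sub_C]

/-- **Elementary-symmetric criterion for a constant multiset** (helper W7 of the line
`cm-pivot-andre`, registered signature verbatim). For a multiset `M` of `d > 0` complex numbers,
`dᵏ · e_k(M) = C(d,k) · e₁(M)ᵏ` for all `k ≤ d` iff `M = replicate d r` for some `r`.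
`⇐`: `e_k(replicate d r) = C(d,k) rᵏ` (`esymm_replicate`), `e₁ = d r`. `⇒`: with `c := e₁(M)/d`
the hypothesis gives `e_k(M) = C(d,k) cᵏ = e_k(replicate d c)` (`k ≤ d`), so by Vieta
(`Multiset.prod_X_add_C_eq_sum_esymm`) `∏_{r ∈ M} (X + r) = (X + c)ᵈ = ∏_{r ∈ replicate d c} (X + r)`,
and comparing roots (`roots_multiset_prod_X_add_C`, `Multiset.map_injective neg_injective`)
`M = replicate d c`. [folklore] -/
theorem esymm_power_criterion : ∀ (d : ℕ) (M : Multiset ℂ), M.card = d → 0 < d → ((∀ k : ℕ, k ≤ d → (d : ℂ) ^ k * M.esymm k = (d.choose k : ℂ) * M.esymm 1 ^ k) ↔ ∃ r : ℂ, M = Multiset.replicate d r) := by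
  intro d M hM hd
  constructor
  · intro h
    have hd0 : (d : ℂ) ≠ 0 := Nat.cast_ne_zero.2 hd.ne'
    set c : ℂ := M.esymm 1 / d with hc
    have h1 : M.esymm 1 = d * c := by rw [hc, mul_div_cancel₀ _ hd0]
    -- the hypothesis at `k` reads `e_k(M) = C(d,k) cᵏ`
    have hesymm : ∀ k, k ≤ d → M.esymm k = (d.choose k : ℂ) * c ^ k := by
      intro k hk
      have hk' := h k hk
      rw [h1, mul_pow, ← mul_assoc, mul_comm (d.choose k : ℂ), mul_assoc] at hk'
      exact mul_left_cancel₀ (pow_ne_zero k hd0) hk'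
    -- Vieta: `∏_{r ∈ M} (X + r) = ∏_{r ∈ replicate d c} (X + r)`
    have hprod : (M.map fun r => X + C r).prod =
        ((Multiset.replicate d c).map fun r => X + C r).prod := by
      rw [Multiset.prod_X_add_C_eq_sum_esymm, Multiset.prod_X_add_C_eq_sum_esymm, hM,
        Multiset.card_replicate]
      refine Finset.sum_congr rfl fun j hj => ?_
      rw [Finset.mem_range] at hj
      rw [hesymm j (Nat.lt_succ_iff.1 hj), esymm_replicate]
    -- compare the roots
    have hroots := congrArg Polynomial.roots hprod
    rw [roots_multiset_prod_X_add_C, roots_multiset_prod_X_add_C] at hroots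
    exact ⟨c, Multiset.map_injective neg_injective hroots⟩
  · rintro ⟨r, rfl⟩ k _
    rw [esymm_replicate, esymm_replicate, Nat.choose_one_right, pow_one]
    ring

end Summit.HodgeConjecture.HodgeConjecture.Theorems.HodgeAbelianVarieties.CMPivotAndre

end
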